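import Summits.BirchSwinnertonDyer.BirchSwinnertonDyer.Theorems.ManinLocalTwoThreeVeluTwoDiscriminant
import Summits.BirchSwinnertonDyer.BirchSwinnertonDyer.Theorems.ManinLocalTwoThreeTameTwoIVstarVeluB
import Summits.BirchSwinnertonDyer.BirchSwinnertonDyer.Theorems.ManinLocalTwoThreeTameCellIVLocalTwoTorsion
import Summits.BirchSwinnertonDyer.Rank1Residual.X5.TwoAdicImageCertificates
import HarnessLib

/-!
# The tame `IV` stratum at `2`: `ord₂ B = 0`, hence the Néron scalar of the Vélu `2`-isogeny is `u = 1` and the quotient has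
# `ord₂ Δ_min = 8` (E-an-120, `IV` half, in full); and the `IV*` bookkeeping (`u = 1` carriers are not tame)

Summit `BirchSwinnertonDyer`, route `ManinLocalTwoThree` (cell bsd-f2-manin), deciding crux C2 `ManinOddAtFour`
(stmt-BirchSwinnertonDyer-22967).  Sequel of `…VeluTwoDiscriminant` (p646201: dichotomy `k ∣ 2` + bookkeeping
`ord_p Δ_min(W′) + 3·ord_p B + 12·ord_p k = 2·ord_p Δ_min(W)`) and `…TameTwoIVstarVeluB` (p646508: `ord₂ B = 0` on `IV*`).

* `odd_veluB_of_odd_cubicDisc` — integer algebra: an integer root `e` of `x³ + a₂x² + a₄x + a₆` with ODD discriminant has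
  `3e² + 2a₂e + a₄` odd (`disc = ((a₂+e)² − 4(a₄ + e(a₂+e)))·(3e² + 2a₂e + a₄)²` on the root).
* `padicValRat_veluB_eq_zero_of_IV` — `W` globally minimal, `4 ∥ N`, `ord₂ Δ_min = 4` (Kodaira `IV`), `Ψ₂²(q − b₂/12) = 0` ⟹
  `ord₂ (3q² − c₄/48) = 0` (the lead's `a₁ = a₃ = 0` companion `M = [0, a₂, 0, a₄, a₆]`, `Δ(M) = 16·disc`, `disc` odd; the torsion
  abscissa is an integer root; `B` is `u = 1`-invariant).
* **E-an-120, `IV` half, PROVED:** `exists_isGloballyMinimal_velu_two_of_IV` (a globally minimal `W′` with the `u = 1` pair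
  `(720q² − 4c₄, 19008q³ − 144c₄q)` EXISTS and has `ord₂ Δ_min(W′) = 8`) and `not_exists_isGloballyMinimal_two_velu_two_of_IV`
  (no globally minimal curve carries the pair divided by `(2⁴, 2⁶)`): the Néron scalar of the `2`-isogeny at `2` is `u = 1` on `IV`.
* `IV*` bookkeeping: `padicValInt_minimalDiscriminantInt_eq_sixteen_of_velu_two_of_IVstar` (a globally minimal carrier of the `u = 1`
  pair of a tame `IV*` curve has `ord₂ Δ_min = 16`, so is NOT tame at `2`) and `…_eq_four_of_two_velu_two_of_IVstar` (a carrier of the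
  halved pair has `ord₂ Δ_min = 4`: type `IV` if tame).

HONEST FRAMING: local theorems; C2, Manin's conjecture and BSD are not proved.  No definitions, no named facts, no sorry.
References: [SilvermanATAEC1994] IV.9.4, Table 4.1; [SilvermanAEC2009] III.1 Table 3.1, VII.1.3; [DokchitserDokchitser2015LocalInvariants]
Table 1; HOME/MEMO-an.md §67 (E-an-119/120: `IV → IV*` with `u = 1`, `IV* → IV` with `u = 2`; census 26 944 / 32 073, 0 exceptions).
-/

set_option autoImplicit false
set_option linter.dupNamespace false

noncomputable section

open scoped Classical
open Polynomial WeierstrassCurve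
open Literature.NumberTheory.DiophantineGeometry

namespace Summit.BirchSwinnertonDyer.BirchSwinnertonDyer.Theorems.ManinLocalTwoThree

/-! ### §1 Integer algebra: odd discriminant ⟹ odd derivative at an integer root -/

/-- An integer root `e` of `x³ + a₂x² + a₄x + a₆` with ODD discriminant has `3e² + 2a₂e + a₄` odd: on the root,
`disc = ((a₂ + e)² − 4(a₄ + e(a₂ + e)))·(3e² + 2a₂e + a₄)²`. [folklore] -/
theorem odd_veluB_of_odd_cubicDisc {a₂ a₄ a₆ e : ℤ} (he : e ^ 3 + a₂ * e ^ 2 + a₄ * e + a₆ = 0)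
    (hodd : ¬ (2 : ℤ) ∣ a₂ ^ 2 * a₄ ^ 2 - 4 * a₄ ^ 3 - 4 * a₂ ^ 3 * a₆ + 18 * a₂ * a₄ * a₆ - 27 * a₆ ^ 2) :
    ¬ (2 : ℤ) ∣ 3 * e ^ 2 + 2 * a₂ * e + a₄ := by
  rintro ⟨k, hk⟩
  refine hodd ⟨2 * k ^ 2 * ((a₂ + e) ^ 2 - 4 * (a₄ + e * (a₂ + e))), ?_⟩
  linear_combination (-27 * a₆ - 4 * a₂ ^ 3 + 18 * a₂ * a₄ + 27 * (e ^ 3 + a₂ * e ^ 2 + a₄ * e)) * he +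
    ((a₂ + e) ^ 2 - 4 * (a₄ + e * (a₂ + e))) * (3 * e ^ 2 + 2 * a₂ * e + a₄ + 2 * k) * hk

/-! ### §2 `ord₂ B = 0` on the tame `IV` stratum -/

/-- **`ord₂ B = 0` on the tame `IV` stratum:** `W` globally minimal, `4 ∥ N`, `ord₂ Δ_min = 4` (Kodaira `IV` at `2`), `q ∈ ℚ` with
`Ψ₂²_W(q − b₂/12) = 0` ⟹ the Vélu quantity `B = 3q² − c₄/48` is a `2`-adic unit.
[cite: SilvermanATAEC1994, IV.9.4 and Table 4.1] [cite: SilvermanAEC2009, III.1 Table 3.1] -/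
theorem padicValRat_veluB_eq_zero_of_IV (W : WeierstrassCurve ℚ) [W.IsElliptic] [W.IsGloballyMinimal]
    (h4 : 2 ^ 2 ∣ W.conductorNorm ℤ) (h8 : ¬ 2 ^ 3 ∣ W.conductorNorm ℤ)
    (hΔ4 : padicValInt 2 W.minimalDiscriminantInt = 4) (q : ℚ) (hq : W.Ψ₂Sq.eval (q - W.b₂ / 12) = 0) :
    padicValRat 2 (3 * q ^ 2 - W.c₄ / 48) = 0 := by
  -- additive reduction at `2`, and the lead's `a₁ = a₃ = 0` globally minimal companion `M`
  set v : IsDedekindDomain.HeightOneSpectrum ℤ := (Rat.HeightOneSpectrum.primesEquiv (R := ℤ)).symm ⟨2, Nat.prime_two⟩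
    with hvdef
  have hv : Rat.HeightOneSpectrum.natGenerator v = 2 :=
    Literature.NumberTheory.EllipticCurves.Rat.natGenerator_primesEquiv_symm ⟨2, Nat.prime_two⟩
  have hf : W.conductorExponent v = 2 := W.conductorExponent_eq_two_of_four_dvd_conductorNorm v hv h4 h8
  have haddZ : W.HasAdditiveReductionAt v := (W.two_le_conductorExponent_iff_holds v).mp (by omega)
  have hadd : W.HasAdditiveReductionAt
      ((Rat.HeightOneSpectrum.primesEquiv (R := NumberField.RingOfIntegers ℚ)).symm ⟨2, Nat.prime_two⟩) :=
    (W.hasAdditiveReductionAt_int_iff_ringOfIntegers ⟨2, Nat.prime_two⟩).mp haddZ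
  obtain ⟨C, M, hu, hCW, hM1, hM3, -⟩ := exists_smul_eq_map_a₁_a₃_eq_zero_of_hasAdditiveReductionAt_two W hadd
  -- `Δ_min(W) = Δ(M) = 16·disc`, `disc` odd (as in the lead's `IV` root analysis)
  set d : ℤ := M.a₂ ^ 2 * M.a₄ ^ 2 - 4 * M.a₄ ^ 3 - 4 * M.a₂ ^ 3 * M.a₆ + 18 * M.a₂ * M.a₄ * M.a₆ - 27 * M.a₆ ^ 2
    with hd
  have hMΔ : M.Δ = 16 * d := by
    rw [hd]
    simp only [WeierstrassCurve.Δ, WeierstrassCurve.b₂, WeierstrassCurve.b₄, WeierstrassCurve.b₆, WeierstrassCurve.b₈,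
      hM1, hM3]
    ring
  have hmin' : W.minimalDiscriminantInt = M.Δ := by
    have h1 : (W.minimalDiscriminantInt : ℚ) = W.Δ := cast_minimalDiscriminantInt W
    have h2 : (C • W).Δ = W.Δ := by rw [variableChange_Δ, hu]; simp
    have h3 : (C • W).Δ = (M.Δ : ℚ) := by rw [hCW, map_Δ, eq_intCast]
    exact_mod_cast (h1.trans (h2.symm.trans h3))
  have hMΔne : M.Δ ≠ 0 := by rw [← hmin']; exact minimalDiscriminantInt_ne_zero W
  have hodd : ¬ (2 : ℤ) ∣ d := by
    rintro ⟨k, hk⟩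
    have h32 : ((2 : ℕ) : ℤ) ^ 5 ∣ M.Δ := ⟨k, by rw [hMΔ, hk]; push_cast; ring⟩
    rw [padicValInt_dvd_iff] at h32
    rcases h32 with h0 | h5
    · exact hMΔne h0
    · rw [← hmin', hΔ4] at h5; omega
  -- the torsion abscissa on `M` is an integer root of `x³ + a₂x² + a₄x + a₆`
  set e : ℚ := q - W.b₂ / 12 - C.r with hedef
  have hb₂M : (C • W).b₂ = (4 * M.a₂ : ℤ) := by
    rw [hCW]; simp only [WeierstrassCurve.b₂, map_a₁, map_a₂, eq_intCast, hM1]; push_cast; ring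
  have hb₄M : (C • W).b₄ = (2 * M.a₄ : ℤ) := by
    rw [hCW]; simp only [WeierstrassCurve.b₄, map_a₁, map_a₃, map_a₄, eq_intCast, hM1, hM3]; push_cast; ring
  have hb₆M : (C • W).b₆ = (4 * M.a₆ : ℤ) := by
    rw [hCW]; simp only [WeierstrassCurve.b₆, map_a₃, map_a₆, eq_intCast, hM3]; push_cast; ring
  have hqQ : 4 * (q - W.b₂ / 12) ^ 3 + W.b₂ * (q - W.b₂ / 12) ^ 2 + 2 * W.b₄ * (q - W.b₂ / 12) + W.b₆ = 0 := by
    simp only [WeierstrassCurve.Ψ₂Sq, eval_add, eval_mul, eval_pow, eval_C, eval_X] at hq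
    linear_combination hq
  have hshift : 4 * e ^ 3 + (C • W).b₂ * e ^ 2 + 2 * (C • W).b₄ * e + (C • W).b₆ = 0 := by
    rw [variableChange_b₂, variableChange_b₄, variableChange_b₆, hu, hedef]
    simp only [inv_one, Units.val_one, one_pow, one_mul]
    linear_combination hqQ
  have heQ : e ^ 3 + (M.a₂ : ℚ) * e ^ 2 + (M.a₄ : ℚ) * e + (M.a₆ : ℚ) = 0 := by
    rw [hb₂M, hb₄M, hb₆M] at hshift
    push_cast at hshift
    linear_combination hshift / 4
  obtain ⟨E, hE⟩ := Summit.BirchSwinnertonDyer.Rank1Residual.X5.O1.exists_intCast_eq_of_cubic_eq_zero heQ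
  have heZ : E ^ 3 + M.a₂ * E ^ 2 + M.a₄ * E + M.a₆ = 0 := by
    have h : ((E ^ 3 + M.a₂ * E ^ 2 + M.a₄ * E + M.a₆ : ℤ) : ℚ) = 0 := by push_cast; rw [hE]; exact heQ
    exact_mod_cast h
  have hBodd := odd_veluB_of_odd_cubicDisc heZ hodd
  -- `B` is `u = 1`-invariant: `3q² − c₄/48 = 3E² + 2a₂E + a₄`
  have hB : (3 * q ^ 2 - W.c₄ / 48 : ℚ) = ((3 * E ^ 2 + 2 * M.a₂ * E + M.a₄ : ℤ) : ℚ) := by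
    have h1 : (3 * q ^ 2 - W.c₄ / 48 : ℚ) = (6 * e ^ 2 + (C • W).b₂ * e + (C • W).b₄) / 2 := by
      rw [variableChange_b₂, variableChange_b₄, hu, hedef, show W.c₄ = W.b₂ ^ 2 - 24 * W.b₄ from rfl]
      simp only [inv_one, Units.val_one, one_pow, one_mul]
      ring
    rw [h1, hb₂M, hb₄M]; push_cast; rw [← hE]; ring
  rw [hB, padicValRat.of_int, Nat.cast_eq_zero, padicValInt, padicValNat.eq_zero_of_not_dvd]
  intro h2
  exact hBodd (Int.natAbs_dvd.mp (Int.natCast_dvd.mpr h2))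

/-! ### §3 E-an-120, `IV` half: the `2`-quotient with `u = 1` EXISTS (and has `ord₂ Δ_min = 8`); no `u = 2` -/

/-- **E-an-120, `IV` half, existence + valuation (PROVED):** on a globally minimal `W` with `4 ∥ N`, `ord₂ Δ_min = 4` and a rational
`2`-torsion abscissa `q` (`Ψ₂²(q − b₂/12) = 0`), some GLOBALLY MINIMAL `W′` carries the `u = 1` Vélu `2`-pair
`(720q² − 4c₄, 19008q³ − 144c₄q)` — and every such `W′` has `ord₂ Δ_min(W′) = 8`.
[cite: SilvermanATAEC1994, IV.9.4 Table 4.1] [cite: DokchitserDokchitser2015LocalInvariants, Table 1] -/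
theorem exists_isGloballyMinimal_velu_two_of_IV (W : WeierstrassCurve ℚ) [W.IsElliptic] [W.IsGloballyMinimal]
    (h4 : 2 ^ 2 ∣ W.conductorNorm ℤ) (h8 : ¬ 2 ^ 3 ∣ W.conductorNorm ℤ)
    (hΔ4 : padicValInt 2 W.minimalDiscriminantInt = 4) (q : ℚ) (hq : W.Ψ₂Sq.eval (q - W.b₂ / 12) = 0) :
    (∃ W' : WeierstrassCurve ℚ, W'.IsElliptic ∧ W'.IsGloballyMinimal ∧
      W'.c₄ = 720 * q ^ 2 - 4 * W.c₄ ∧ W'.c₆ = 19008 * q ^ 3 - 144 * W.c₄ * q) ∧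
    ∀ (W' : WeierstrassCurve ℚ) [W'.IsElliptic] [W'.IsGloballyMinimal],
      W'.c₄ = 720 * q ^ 2 - 4 * W.c₄ → W'.c₆ = 19008 * q ^ 3 - 144 * W.c₄ * q →
        padicValInt 2 W'.minimalDiscriminantInt = 8 := by
  haveI : Fact (Nat.Prime 2) := ⟨Nat.prime_two⟩
  have hB := padicValRat_veluB_eq_zero_of_IV W h4 h8 hΔ4 q hq
  have hval : ∀ (W' : WeierstrassCurve ℚ) [W'.IsElliptic] [W'.IsGloballyMinimal],
      W'.c₄ = 720 * q ^ 2 - 4 * W.c₄ → W'.c₆ = 19008 * q ^ 3 - 144 * W.c₄ * q →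
        padicValInt 2 W'.minimalDiscriminantInt = 8 := by
    intro W' _ _ h4' h6'
    have h := padicValRat_velu_two_Δ 2 W q hq W' h4' h6'
    rw [hB, ← cast_minimalDiscriminantInt W', ← cast_minimalDiscriminantInt W, padicValRat.of_int, padicValRat.of_int,
      hΔ4] at h
    push_cast at h
    omega
  refine ⟨?_, hval⟩
  obtain ⟨W', k, hE', hM', hk, hk0, h4', h6', hbook⟩ := exists_isGloballyMinimal_dvd_two_velu_two W q hq
  -- `k = ±1`: `k = ±2` would give `ord₂ Δ_min(W′) = 8 − 12 < 0`
  have hb := hbook 2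
  rw [hB, hΔ4] at hb
  push_cast at hb
  have hk1 : k = 1 ∨ k = -1 := by
    have hk2 : k.natAbs ≤ 2 := by simpa using Nat.le_of_dvd two_pos (Int.natAbs_dvd_natAbs.mpr hk)
    have hlo : -2 ≤ k := by omega
    have hhi : k ≤ 2 := by omega
    have h0 : (0 : ℤ) ≤ padicValInt 2 W'.minimalDiscriminantInt := by positivity
    have hv2 : padicValInt 2 2 = 1 := padicValInt_self
    have hv2' : padicValInt 2 (-2) = 1 := by
      rw [show padicValInt 2 (-2) = padicValInt 2 2 from by simp [padicValInt]]; exact padicValInt_self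
    interval_cases k
    · exfalso; rw [hv2'] at hb; push_cast at hb; omega
    · exact Or.inr rfl
    · exact absurd rfl hk0
    · exact Or.inl rfl
    · exfalso; rw [hv2] at hb; push_cast at hb; omega
  have hk4 : (k : ℚ) ^ 4 = 1 := by rcases hk1 with rfl | rfl <;> norm_num
  have hk6 : (k : ℚ) ^ 6 = 1 := by rcases hk1 with rfl | rfl <;> norm_num
  rw [hk4, one_mul] at h4'
  rw [hk6, one_mul] at h6'
  exact ⟨W', hE', hM', h4', h6'⟩

/-- **E-an-120, `IV` half, uniqueness of the scalar (PROVED):** on the tame `IV` stratum NO globally minimal curve carries the Vélu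
`2`-pair divided by `(2⁴, 2⁶)` (it would have `ord₂ Δ_min = −4`): the Néron scalar at `2` of the `2`-isogeny is `u = 1`, never `2`.
[cite: SilvermanATAEC1994, IV.9.4 Table 4.1] -/
theorem not_exists_isGloballyMinimal_two_velu_two_of_IV (W : WeierstrassCurve ℚ) [W.IsElliptic] [W.IsGloballyMinimal]
    (h4 : 2 ^ 2 ∣ W.conductorNorm ℤ) (h8 : ¬ 2 ^ 3 ∣ W.conductorNorm ℤ)
    (hΔ4 : padicValInt 2 W.minimalDiscriminantInt = 4) (q : ℚ) (hq : W.Ψ₂Sq.eval (q - W.b₂ / 12) = 0) :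
    ¬ ∃ W' : WeierstrassCurve ℚ, W'.IsElliptic ∧ W'.IsGloballyMinimal ∧
      (2 : ℚ) ^ 4 * W'.c₄ = 720 * q ^ 2 - 4 * W.c₄ ∧ (2 : ℚ) ^ 6 * W'.c₆ = 19008 * q ^ 3 - 144 * W.c₄ * q := by
  rintro ⟨W', hE', hM', h4', h6'⟩
  haveI := hE'; haveI := hM'
  haveI : Fact (Nat.Prime 2) := ⟨Nat.prime_two⟩
  have hB := padicValRat_veluB_eq_zero_of_IV W h4 h8 hΔ4 q hq
  -- the model `T = (2⁴c₄′, 2⁶c₆′)`, i.e. `⟨1/2, 0, 0, 0⟩ • W′`, carries the `u = 1` pair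
  set T : WeierstrassCurve ℚ := (⟨⟨(1 / 2 : ℚ), 2, by norm_num, by norm_num⟩, 0, 0, 0⟩ : VariableChange ℚ) • W' with hT
  have hT4 : T.c₄ = 720 * q ^ 2 - 4 * W.c₄ := by
    rw [← h4', hT, variableChange_c₄]; simp
  have hT6 : T.c₆ = 19008 * q ^ 3 - 144 * W.c₄ * q := by
    rw [← h6', hT, variableChange_c₆]; simp
  have h := padicValRat_velu_two_Δ 2 W q hq T hT4 hT6
  have hTΔ : T.Δ = 2 ^ 12 * W'.Δ := by rw [hT, variableChange_Δ]; simp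
  have hW'Δ : W'.Δ ≠ 0 := by rw [← WeierstrassCurve.coe_Δ']; exact W'.Δ'.ne_zero
  have h2v : padicValRat 2 (2 : ℚ) = 1 := by exact_mod_cast padicValRat.self (p := 2) (by norm_num)
  rw [hTΔ, padicValRat.mul (by norm_num) hW'Δ, padicValRat.pow (2 : ℚ), h2v] at h
  rw [hB, ← cast_minimalDiscriminantInt W', ← cast_minimalDiscriminantInt W, padicValRat.of_int, padicValRat.of_int,
    hΔ4] at h
  push_cast at h
  have h0 : (0 : ℤ) ≤ padicValInt 2 W'.minimalDiscriminantInt := by positivity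
  omega

/-! ### §4 `IV*` bookkeeping: the `u = 1` carrier is not tame, the halved carrier is of type `IV` -/

/-- On the tame `IV*` stratum every globally minimal carrier of the `u = 1` Vélu `2`-pair has `ord₂ Δ_min = 16` (so it is NOT tame
at `2`; under conductor invariance of the isogeny this case is void — cf. `…NoDoublingIVstarFourP`). [cite: SilvermanATAEC1994, IV.9.4 Table 4.1] -/
theorem padicValInt_minimalDiscriminantInt_eq_sixteen_of_velu_two_of_IVstar (W : WeierstrassCurve ℚ) [W.IsElliptic]
    [W.IsGloballyMinimal] (h4 : 2 ^ 2 ∣ W.conductorNorm ℤ) (h8 : ¬ 2 ^ 3 ∣ W.conductorNorm ℤ)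
    (hΔ8 : padicValInt 2 W.minimalDiscriminantInt = 8) (q : ℚ) (hq : W.Ψ₂Sq.eval (q - W.b₂ / 12) = 0)
    (W' : WeierstrassCurve ℚ) [W'.IsElliptic] [W'.IsGloballyMinimal]
    (h4' : W'.c₄ = 720 * q ^ 2 - 4 * W.c₄) (h6' : W'.c₆ = 19008 * q ^ 3 - 144 * W.c₄ * q) :
    padicValInt 2 W'.minimalDiscriminantInt = 16 := by
  haveI : Fact (Nat.Prime 2) := ⟨Nat.prime_two⟩
  have hB := padicValRat_veluB_eq_zero_of_IVstar W h4 h8 hΔ8 q hq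
  have h := padicValRat_velu_two_Δ 2 W q hq W' h4' h6'
  rw [hB, ← cast_minimalDiscriminantInt W', ← cast_minimalDiscriminantInt W, padicValRat.of_int, padicValRat.of_int,
    hΔ8] at h
  push_cast at h
  omega

/-- On the tame `IV*` stratum every globally minimal carrier of the Vélu `2`-pair divided by `(2⁴, 2⁶)` (Néron scalar `u = 2`) has
`ord₂ Δ_min = 4` (type `IV` when tame: E-an-119's `IV* → IV`). [cite: SilvermanATAEC1994, IV.9.4 Table 4.1]
[cite: DokchitserDokchitser2015LocalInvariants, Table 1] -/
theorem padicValInt_minimalDiscriminantInt_eq_four_of_two_velu_two_of_IVstar (W : WeierstrassCurve ℚ) [W.IsElliptic]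
    [W.IsGloballyMinimal] (h4 : 2 ^ 2 ∣ W.conductorNorm ℤ) (h8 : ¬ 2 ^ 3 ∣ W.conductorNorm ℤ)
    (hΔ8 : padicValInt 2 W.minimalDiscriminantInt = 8) (q : ℚ) (hq : W.Ψ₂Sq.eval (q - W.b₂ / 12) = 0)
    (W' : WeierstrassCurve ℚ) [W'.IsElliptic] [W'.IsGloballyMinimal]
    (h4' : (2 : ℚ) ^ 4 * W'.c₄ = 720 * q ^ 2 - 4 * W.c₄) (h6' : (2 : ℚ) ^ 6 * W'.c₆ = 19008 * q ^ 3 - 144 * W.c₄ * q) :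
    padicValInt 2 W'.minimalDiscriminantInt = 4 := by
  haveI : Fact (Nat.Prime 2) := ⟨Nat.prime_two⟩
  have hB := padicValRat_veluB_eq_zero_of_IVstar W h4 h8 hΔ8 q hq
  set T : WeierstrassCurve ℚ := (⟨⟨(1 / 2 : ℚ), 2, by norm_num, by norm_num⟩, 0, 0, 0⟩ : VariableChange ℚ) • W' with hT
  have hT4 : T.c₄ = 720 * q ^ 2 - 4 * W.c₄ := by
    rw [← h4', hT, variableChange_c₄]; simp
  have hT6 : T.c₆ = 19008 * q ^ 3 - 144 * W.c₄ * q := by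
    rw [← h6', hT, variableChange_c₆]; simp
  have h := padicValRat_velu_two_Δ 2 W q hq T hT4 hT6
  have hTΔ : T.Δ = 2 ^ 12 * W'.Δ := by rw [hT, variableChange_Δ]; simp
  have hW'Δ : W'.Δ ≠ 0 := by rw [← WeierstrassCurve.coe_Δ']; exact W'.Δ'.ne_zero
  have h2v : padicValRat 2 (2 : ℚ) = 1 := by exact_mod_cast padicValRat.self (p := 2) (by norm_num)
  rw [hTΔ, padicValRat.mul (by norm_num) hW'Δ, padicValRat.pow (2 : ℚ), h2v] at h
  rw [hB, ← cast_minimalDiscriminantInt W', ← cast_minimalDiscriminantInt W, padicValRat.of_int, padicValRat.of_int,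
    hΔ8] at h
  push_cast at h
  omega

end Summit.BirchSwinnertonDyer.BirchSwinnertonDyer.Theorems.ManinLocalTwoThree

end
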